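import Literature.Analysis.FluidPDE.NewtonFarGradPotential
import Literature.Analysis.FluidPDE.BiotSavartNewtonKernel
import Literature.Analysis.FluidPDE.NewtonPotentialTestSource
import Literature.Analysis.FluidPDE.NewtonPotentialGradientFarField
import HarnessLib

/-!
# Route `ExtremiserTransience`, crux `NearExtremalTransiencePerFlow` (stmt-NavierStokesRegularity-26567), LINE g10-1 «two_thirds»
# (ns-idea-10 g10), stub S2 `FirstOrderIdentity`: FAR-FIELD DERIVATIVE BOUNDS for the harmonic remainder of the gauge

Helper file for S2 (`--supports stmt-NavierStokesRegularity-26567`).  The gauge `ψ = K ∗ (ζV)` of S2 has `curl ψ = ζV − ∇q`,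
`q = Γ ∗ div(ζV)` (file `…TwoThirdsGauge`), and the source `div(ζV) = ∇ζ·V` lives in the far shell of the truncation.  This file
bounds the first and second derivatives of a Newtonian potential `q(x) = ∫ Γ(x−y) g(y) dy` at a point `x` at distance `≥ d`
from the support of a continuous compactly supported `g`:

* `newtonPotential_eventuallyEq_far` — near `x`, `q` coincides with the potential of the SMOOTH far kernel `Γ∞ = newtonFar (d/4) (d/2)`;
* `hasFDerivAt_newtonPotential_far`, `norm_fderiv_newtonPotential_le_far` — `Dq(x) = ∫ DΓ(x−y) g(y) dy`,
  `‖Dq(x)‖ ≤ (4πd²)⁻¹ ∫|g|`;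
* `fderiv_newtonPotential_apply_eventuallyEq_far`, `abs_fderiv_fderiv_newtonPotential_le_far` — `∂_b∂_a q(x) = ∫ D²Γ(x−y)(b,a) g(y) dy`,
  `|∂_b∂_a q(x)| ≤ ‖a‖‖b‖/(πd³) · ∫|g|`;
* `contDiff_newtonPotential_of_test` — for smooth compactly supported `g`, `q` is smooth everywhere.

HONEST FRAMING: potential theory on `ℝ³` (Gilbarg–Trudinger Lemma 4.1-type bookkeeping over the tree's `newtonFar` kernels);
nothing about Navier–Stokes regularity or blow-up is proved; S2, the crux ⟨26567⟩ and NS regularity are OPEN; no summit is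
proved by a line. [folklore]
-/

noncomputable section

open MeasureTheory Set Filter Topology Metric
open scoped ENNReal NNReal RealInnerProductSpace ContDiff Convolution
open Literature.Analysis.FluidPDE ContinuousLinearMap

namespace Summit.NavierStokesRegularity.NavierStokesRegularity.Theorems.NearExtremalTransiencePerFlow.TwoThirds

-- the summit's namespace repeats the problem name by convention (D-0017)
set_option linter.dupNamespace false
-- nested operator types (second derivatives)
set_option maxSynthPendingDepth 3

variable {g : EuclideanSpace ℝ (Fin 3) → ℝ} {x : EuclideanSpace ℝ (Fin 3)} {d : ℝ}

/-- Geometry of the far region: if `g` vanishes within distance `d` of `x`, then for `x'` within `d/2` of `x` every point of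
the support of `g` is at distance `≥ d/2` from `x'`. [folklore] -/
theorem half_le_norm_sub_of_far (hfar : ∀ y, g y ≠ 0 → d ≤ ‖x - y‖) {x' y : EuclideanSpace ℝ (Fin 3)}
    (hx' : ‖x' - x‖ < d / 2) (hy : g y ≠ 0) : d / 2 ≤ ‖x' - y‖ := by
  have h1 := hfar y hy
  have h2 : ‖x - y‖ ≤ ‖x - x'‖ + ‖x' - y‖ := norm_sub_le_norm_sub_add_norm_sub x x' y
  rw [norm_sub_rev x x'] at h2
  linarith

/-- Near a far point, the Newtonian potential of `g` is the potential of the smooth far kernel `Γ∞ = newtonFar (d/4) (d/2)`.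
[folklore] -/
theorem newtonPotential_eventuallyEq_far (hd : 0 < d) (hfar : ∀ y, g y ≠ 0 → d ≤ ‖x - y‖) :
    (fun x' => ∫ y, newtonKernel (x' - y) * g y) =ᶠ[𝓝 x]
      fun x' => ∫ y, newtonFar (d / 4) (d / 2) (x' - y) • g y := by
  filter_upwards [Metric.ball_mem_nhds x (by positivity : 0 < d / 2)] with x' hx'
  rw [mem_ball, dist_eq_norm] at hx'
  refine integral_congr_ae (Eventually.of_forall fun y => ?_)
  show newtonKernel (x' - y) * g y = newtonFar (d / 4) (d / 2) (x' - y) • g y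
  by_cases hy : g y = 0
  · simp [hy]
  · rw [smul_eq_mul, newtonFar_eq_newtonKernel (by positivity) (by linarith) (half_le_norm_sub_of_far hfar hx' hy)]

/-- **First derivative of a Newtonian potential at a far point**: `Dq(x) = ∫ DΓ(x−y)(·) g(y) dy`. [folklore] -/
theorem hasFDerivAt_newtonPotential_far (hg : Continuous g) (hgc : HasCompactSupport g) (hd : 0 < d)
    (hfar : ∀ y, g y ≠ 0 → d ≤ ‖x - y‖) :
    HasFDerivAt (fun x' => ∫ y, newtonKernel (x' - y) * g y)
      (∫ y, (fderiv ℝ newtonKernel (x - y)).smulRight (g y)) x := by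
  have h₀ : 0 < d / 4 := by positivity
  have h₁ : d / 4 < d / 2 := by linarith
  obtain ⟨-, ⟨D, hD⟩, -⟩ := exists_bound_newtonFar_derivs h₀ h₁
  have hk : ContDiff ℝ 1 (newtonFar (d / 4) (d / 2)) := contDiff_newtonFar h₀ h₁
  have hfar' := hasFDerivAt_integral_bddKernel_sub_smul hk hD hg hgc x
  -- the derivative integrands agree on the support of `g`
  have e : ∫ y, (fderiv ℝ (newtonFar (d / 4) (d / 2)) (x - y)).smulRight (g y) =
      ∫ y, (fderiv ℝ newtonKernel (x - y)).smulRight (g y) := by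
    refine integral_congr_ae (Eventually.of_forall fun y => ?_)
    show (fderiv ℝ (newtonFar (d / 4) (d / 2)) (x - y)).smulRight (g y) = (fderiv ℝ newtonKernel (x - y)).smulRight (g y)
    by_cases hy : g y = 0
    · simp [hy]
    · have hz : d / 2 < ‖x - y‖ := by linarith [hfar y hy]
      rw [(newtonFar_fderiv_iterates_eq h₀.le h₁ hz).2.1]
  rw [← e]
  exact hfar'.congr_of_eventuallyEq (newtonPotential_eventuallyEq_far hd hfar)

/-- **`‖Dq(x)‖ ≤ (4πd²)⁻¹ ∫|g|`** at a point `x` at distance `≥ d` from the support of `g`. [folklore] -/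
theorem norm_fderiv_newtonPotential_le_far (hg : Continuous g) (hgc : HasCompactSupport g) (hd : 0 < d)
    (hfar : ∀ y, g y ≠ 0 → d ≤ ‖x - y‖) :
    ‖fderiv ℝ (fun x' => ∫ y, newtonKernel (x' - y) * g y) x‖ ≤ (4 * Real.pi * d ^ 2)⁻¹ * ∫ y, |g y| := by
  rw [(hasFDerivAt_newtonPotential_far hg hgc hd hfar).fderiv, ← integral_const_mul]
  refine norm_integral_le_of_norm_le ((hg.abs.integrable_of_hasCompactSupport hgc.abs).const_mul _)
    (Eventually.of_forall fun y => ?_)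
  by_cases hy : g y = 0
  · simp [hy]
  · have hxy : d ≤ ‖x - y‖ := hfar y hy
    have hpos : 0 < ‖x - y‖ := hd.trans_le hxy
    rw [ContinuousLinearMap.norm_smulRight_apply, Real.norm_eq_abs]
    refine mul_le_mul_of_nonneg_right ?_ (abs_nonneg _)
    calc ‖fderiv ℝ newtonKernel (x - y)‖ ≤ (4 * Real.pi * ‖x - y‖ ^ 2)⁻¹ := norm_fderiv_newtonKernel_le (x - y)
      _ ≤ (4 * Real.pi * d ^ 2)⁻¹ := by
          apply inv_anti₀ (by positivity)
          gcongr

/-- Near a far point, the directional derivative `∂_a q` is the far gradient potential `T∞_a g` of the tree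
(`newtonFarGradPotential (d/4) (d/2) a g`). [folklore] -/
theorem fderiv_newtonPotential_apply_eventuallyEq_far (hg : Continuous g) (hgc : HasCompactSupport g) (hd : 0 < d)
    (hfar : ∀ y, g y ≠ 0 → d ≤ ‖x - y‖) (a : EuclideanSpace ℝ (Fin 3)) :
    (fun x' => fderiv ℝ (fun x'' => ∫ y, newtonKernel (x'' - y) * g y) x' a) =ᶠ[𝓝 x]
      newtonFarGradPotential (d / 4) (d / 2) a g := by
  have h₀ : 0 < d / 4 := by positivity
  have h₁ : d / 4 < d / 2 := by linarith
  obtain ⟨-, ⟨D, hD⟩, -⟩ := exists_bound_newtonFar_derivs h₀ h₁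
  have hk : ContDiff ℝ 1 (newtonFar (d / 4) (d / 2)) := contDiff_newtonFar h₀ h₁
  -- the two potentials agree on an open neighbourhood, hence so do their derivatives
  have heq : (fun x' => ∫ y, newtonKernel (x' - y) * g y) =ᶠ[𝓝 x]
      fun x' => ∫ y, newtonFar (d / 4) (d / 2) (x' - y) • g y := newtonPotential_eventuallyEq_far hd hfar
  filter_upwards [heq.eventuallyEq_nhds] with x' hx'
  rw [hx'.fderiv_eq, fderiv_integral_bddKernel_sub_smul_apply hk hD hg hgc x' a]
  rfl

/-- **`|∂_b∂_a q(x)| ≤ ‖a‖‖b‖/(πd³) · ∫|g|`** at a point `x` at distance `≥ d` from the support of `g`, together with the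
differentiability of `x' ↦ ∂_a q(x')` at `x`. [folklore] -/
theorem abs_fderiv_fderiv_newtonPotential_le_far (hg : Continuous g) (hgc : HasCompactSupport g) (hd : 0 < d)
    (hfar : ∀ y, g y ≠ 0 → d ≤ ‖x - y‖) (a b : EuclideanSpace ℝ (Fin 3)) :
    DifferentiableAt ℝ (fun x' => fderiv ℝ (fun x'' => ∫ y, newtonKernel (x'' - y) * g y) x' a) x ∧
    |fderiv ℝ (fun x' => fderiv ℝ (fun x'' => ∫ y, newtonKernel (x'' - y) * g y) x' a) x b| ≤
      ‖a‖ * ‖b‖ / (Real.pi * d ^ 3) * ∫ y, |g y| := by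
  have h₀ : 0 < d / 4 := by positivity
  have h₁ : d / 4 < d / 2 := by linarith
  have heq := fderiv_newtonPotential_apply_eventuallyEq_far hg hgc hd hfar a
  have hT := hasFDerivAt_newtonFarGradPotential (F := ℝ) h₀ h₁ a hg hgc x
  refine ⟨(hT.differentiableAt).congr_of_eventuallyEq heq, ?_⟩
  rw [heq.fderiv_eq, fderiv_newtonFarGradPotential_apply h₀ h₁ a hg hgc x b, ← integral_const_mul]
  have hint : Integrable fun y => ‖a‖ * ‖b‖ / (Real.pi * d ^ 3) * |g y| :=
    (hg.abs.integrable_of_hasCompactSupport hgc.abs).const_mul _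
  refine (Real.norm_eq_abs _ ▸ norm_integral_le_of_norm_le hint (Eventually.of_forall fun y => ?_))
  by_cases hy : g y = 0
  · simp [hy]
  · have hxy : d ≤ ‖x - y‖ := hfar y hy
    have hpos : 0 < ‖x - y‖ := hd.trans_le hxy
    have hne : x - y ≠ 0 := norm_pos_iff.1 hpos
    have hz : d / 2 < ‖x - y‖ := by linarith
    -- `newtonFarHess a b (x−y) = D²Γ(x−y) b a`, of size `≤ ‖a‖‖b‖/(π‖x−y‖³)`
    have hH : newtonFarHess (d / 4) (d / 2) a b (x - y) = fderiv ℝ (fderiv ℝ newtonKernel) (x - y) b a := by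
      unfold newtonFarHess
      rw [(newtonFar_fderiv_iterates_eq h₀.le h₁ hz).2.2.1]
    have hent : |fderiv ℝ (fderiv ℝ newtonKernel) (x - y) b a| ≤ ‖a‖ * ‖b‖ / (Real.pi * ‖x - y‖ ^ 3) := by
      calc |fderiv ℝ (fderiv ℝ newtonKernel) (x - y) b a| = ‖fderiv ℝ (fderiv ℝ newtonKernel) (x - y) b a‖ :=
            (Real.norm_eq_abs _).symm
        _ ≤ ‖fderiv ℝ (fderiv ℝ newtonKernel) (x - y) b‖ * ‖a‖ := ContinuousLinearMap.le_opNorm _ _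
        _ ≤ ‖fderiv ℝ (fderiv ℝ newtonKernel) (x - y)‖ * ‖b‖ * ‖a‖ :=
            mul_le_mul_of_nonneg_right (ContinuousLinearMap.le_opNorm _ _) (norm_nonneg _)
        _ ≤ 1 / (Real.pi * ‖x - y‖ ^ 3) * ‖b‖ * ‖a‖ := by
            gcongr
            exact norm_fderiv2_newtonKernel_le hne
        _ = ‖a‖ * ‖b‖ / (Real.pi * ‖x - y‖ ^ 3) := by ring
    rw [smul_eq_mul, Real.norm_eq_abs, abs_mul, hH]
    calc |fderiv ℝ (fderiv ℝ newtonKernel) (x - y) b a| * |g y|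
        ≤ ‖a‖ * ‖b‖ / (Real.pi * ‖x - y‖ ^ 3) * |g y| := mul_le_mul_of_nonneg_right hent (abs_nonneg _)
      _ ≤ ‖a‖ * ‖b‖ / (Real.pi * d ^ 3) * |g y| := by
          refine mul_le_mul_of_nonneg_right ?_ (abs_nonneg _)
          apply div_le_div_of_nonneg_left (by positivity) (by positivity)
          gcongr

/-- The Newtonian potential `q = Γ ∗ g` of a smooth compactly supported `g` is smooth on all of `ℝ³`
(`contDiff_convolution_newtonKernel`; needed to form the smooth test field `χ∇q` of S2). [folklore] -/
theorem contDiff_newtonPotential_of_test (hg : ContDiff ℝ (⊤ : ℕ∞) g) (hgc : HasCompactSupport g) :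
    ContDiff ℝ (⊤ : ℕ∞) fun x => ∫ y, newtonKernel (x - y) * g y := by
  have e : (fun x => ∫ y, newtonKernel (x - y) * g y) = (g ⋆[lsmul ℝ ℝ, volume] newtonKernel) :=
    funext fun x => (convolution_newtonKernel_apply' g x).symm
  rw [e]
  exact contDiff_convolution_newtonKernel hg hgc

end Summit.NavierStokesRegularity.NavierStokesRegularity.Theorems.NearExtremalTransiencePerFlow.TwoThirds

end
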